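import Literature.NumberTheory.LFunctions.ExceptionalCharacterPrimesInProgressions
import HarnessLib

/-!
# Primes in arithmetic progressions beyond level `1/2` in the presence of an exceptional
# character: Wright's relaxation of Friedlander–Iwaniec 2003 (preprint 2023; CLAIMS)

Topic `Literature/NumberTheory/LFunctions` (namespace `Literature.NumberTheory.LFunctions`).
STATEMENT LAYER for the cell `parity-realchar` (SIEGEL INSTRUMENT, D-0070 deliverable (3), topic I.2
"primes in arithmetic progressions / Linnik" — an additional SOURCE of the topic, next to
`FriedlanderIwaniec2003_psi` of `ExceptionalCharacterPrimesInProgressions.lean`). Source: T. Wright,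
*Prime Distribution and Siegel Zeroes*, arXiv:2311.12470 (2023) [Wright2023PrimeDistributionSiegel] —
a PREPRINT, arXiv-only (zbMATH lists no journal version): every statement below is a CLAIM
(D-0012, `[claim: …, status: under-review]`), typed AS PRINTED from the held copy, §3 "Main
Theorems" (the two displayed theorems and Corollary 3.1, p. 5) and §5 Corollary 5.2 (p. 7);
nothing is proved here and nothing is asserted.

The setting (§3): "Let `χ` be a real character mod `D`. For `β` with `0 < β < 1`, let `x` be such
that `(log x)^{1−β} ≥ log D` and `(log x)^{β/2} ≫ |log(L(1,χ))|`; for any `ε > 0`, let `q = x^θ` with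
`θ < 16/31 − ε`, and let `(a,q) = 1`." Rendering choices (all in the safe direction or literal):
`χ` primitive quadratic mod `D ≥ 3` as in every file of this column (the paper's "real character
mod `D`"; `L(1,χ)` enters through its norm); the hypothesis "`(log x)^{β/2} ≫ |log L(1,χ)|`" as
"`(log x)^{β/2} ≥ c |log ‖L(1,χ)‖|` for SOME constant `c > 0` supplied by the theorem" (the weaker
reading of a `≫`-hypothesis); "`q = x^θ`, `θ < 16/31 − ε`" as "`q ≤ x^{16/31 − ε}`"; `ψ(x, q, a)` =
the tree's `ParityWave0.chebyshevPsiMod`, `ψ(x)` = Mathlib's `Chebyshev.psi`; the twist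
`χ(aD/(q,D))` = `χ` at the natural number `a · (D / gcd(q, D))`; `q ∼ Q` = `Q ≤ q ≤ 2Q`; the
`max_{(a,q)=1}` inside the `q`-sum is realised junk-free by an arbitrary choice function `a : ℕ → ℕ`
of residues coprime to `q` (equivalent to the maximum), as in the tree's `parity.S27`.

VERSION CAVEAT (added 2026-08-26, same day, by the typing seat; audit:p420253 filed): the held
copy is arXiv **v1**. The author's sequel arXiv:2507.10780 cites "[WrSiAP] =
arxiv.org/html/2311.12470v2" and reports this paper's results as WEAKER than the v1 displays typed
below — pointwise `θ < 30/59 − ε` with `L(1,χ) = o((log D)^{−7})` (v1: `16/31`, `log^{9+2β}`) and the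
Elliott–Halberstam-type average for `θ < 16/31 − ε` (v1: `10/19`). Accordingly the three v1 claims
`wright2023_primesAP_pointwise`, `_onAverage`, `_corollary31` carry status `disputed` (superseded by
the author's own revision; to be re-typed from v2 when held, acq-11239); `wright2023_brunTitchmarsh_exceptional`
(Cor 5.2) is not known to be affected and stays `under-review` (its rendering was amended the same
day to carry the §3 / Lemma 5.1 standing context — `β`, `(log x)^{1−β} ≥ log D`,
`(log x)^{β/2} ≫ |log L(1,χ)|`, `(a,q) = 1` — after the referee's V91 flag). NO CONSUMER may rest on
the v1 exponents.

CAVEAT recorded for the referee's C-audit: the displayed Main Theorem (i) prints the error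
`O(L(1,χ) log^{9−8β} x + q^{15/16+ε})` INSIDE the factor `ψ(x)/φ(q)`, while the proof carries the
Kloosterman term additively (`≪ (x/q) L(1,χ) log³x + q^{15/16+ε}`, Theorem 5.4 (i), and §9 where it
is absorbed using `L(1,χ) ≫ q^{−γ}`); we type the display AS PRINTED, which — `ψ(x)/φ(q) ≥ 1` in
the range — is the WEAKER reading. WHAT THIS IS NOT: no endorsement of the preprint; no claim about
exceptional characters; nothing here bears on parity. No instances, no notation.
-/

noncomputable section

open scoped Classical

namespace Literature.NumberTheory.LFunctions

open Literature.NumberTheory.Sieve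

/-- **Wright 2023 (preprint), Main Theorem (i) — CLAIM, as printed.** "Let `χ` be a real character
mod `D`. For `β` with `0 < β < 1`, let `x` be such that `(log x)^{1−β} ≥ log D` and
`(log x)^{β/2} ≫ |log(L(1,χ))|`; for any `ε > 0`, let `q = x^θ` with `θ < 16/31 − ε`, and let
`(a,q) = 1`. Then
`ψ(x,q,a) = (ψ(x)/φ(q)) (1 − χ(aD/(q,D)) + O(L(1,χ) log^{9−8β} x + q^{15/16+ε}))`.
This is non-trivial if `L(1,χ) log⁹ x = O(1)`." (Improves Friedlander–Iwaniec 2003's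
`θ < 233/462`, `R = 554 401^{554 401}` to `θ < 16/31`, `R > 9`.) Rendered: for all `β ∈ (0,1)` and
`ε > 0` there are `c, K > 0` such that for every `D ≥ 3`, primitive quadratic `χ` mod `D`, real
`x ≥ 2` with `(log x)^{1−β} ≥ log D` and `(log x)^{β/2} ≥ c |log ‖L(1,χ)‖|`, every modulus
`1 ≤ q ≤ x^{16/31 − ε}` and every `a` coprime to `q`:
`|ψ(x,q,a) − (ψ(x)/φ(q))(1 − χ(a·D/(q,D)))| ≤ K (ψ(x)/φ(q)) (‖L(1,χ)‖ (log x)^{9−8β} + q^{15/16+ε})`.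
UNREFEREED; not proved here. arXiv v1 display — SUPERSEDED by the author's v2 (`θ < 30/59 − ε`,
`L(1,χ) = o((log D)^{−7})`, as reported in arXiv:2507.10780 §2); see the module's VERSION CAVEAT.
[claim: Wright2023PrimeDistributionSiegel, status: disputed] -/
def wright2023_primesAP_pointwise : Prop :=
  ∀ β : ℝ, 0 < β → β < 1 → ∀ ε : ℝ, 0 < ε → ∃ c : ℝ, 0 < c ∧ ∃ K : ℝ, 0 < K ∧
    ∀ (D : ℕ) [NeZero D], 3 ≤ D → ∀ χ : DirichletCharacter ℂ D, χ.IsPrimitive → χ.IsQuadratic →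
      ∀ x : ℝ, 2 ≤ x → Real.log D ≤ Real.log x ^ (1 - β) →
        c * |Real.log ‖χ.LFunction 1‖| ≤ Real.log x ^ (β / 2) →
          ∀ q : ℕ, 1 ≤ q → (q : ℝ) ≤ x ^ ((16 : ℝ) / 31 - ε) → ∀ a : ℕ, a.Coprime q →
            |ParityWave0.chebyshevPsiMod q (a : ZMod q) x -
                Chebyshev.psi x / (q.totient : ℝ) *
                  (1 - (χ ((a * (D / Nat.gcd q D) : ℕ) : ZMod D)).re)| ≤
              K * (Chebyshev.psi x / (q.totient : ℝ)) *
                (‖χ.LFunction 1‖ * Real.log x ^ (9 - 8 * β) + (q : ℝ) ^ ((15 : ℝ) / 16 + ε))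

/-- **Wright 2023 (preprint), Main Theorem (ii) — CLAIM, as printed.** "Let `χ`, `D`, `x`, and `β`
be as in Main Theorem (i), and let `Q = x^θ` with `θ < 10/19 − ε` for any `ε > 0`. Then
`∑_{q ∼ Q} max_{(a,q)=1} |ψ(x,q,a) − (ψ(x)/φ(q))(1 − χ(aD/(q,D)))| ≪ x L(1,χ) log^{9−8β} x + Q^{19/10+ε}`."
("one can improve the level of distribution if one is willing to settle for an Elliott–Halberstam-type
result.") Rendered with `q ∼ Q` = `⌈Q⌉ ≤ q ≤ ⌊2Q⌋` and the inner maximum as an arbitrary choice of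
coprime residues `a q`. UNREFEREED; not proved here. arXiv v1 display — SUPERSEDED by the
author's v2 (`θ < 16/31 − ε` for the average form, as reported in arXiv:2507.10780 §2); see the
module's VERSION CAVEAT. [claim: Wright2023PrimeDistributionSiegel, status: disputed] -/
def wright2023_primesAP_onAverage : Prop :=
  ∀ β : ℝ, 0 < β → β < 1 → ∀ ε : ℝ, 0 < ε → ∃ c : ℝ, 0 < c ∧ ∃ K : ℝ, 0 < K ∧
    ∀ (D : ℕ) [NeZero D], 3 ≤ D → ∀ χ : DirichletCharacter ℂ D, χ.IsPrimitive → χ.IsQuadratic →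
      ∀ x : ℝ, 2 ≤ x → Real.log D ≤ Real.log x ^ (1 - β) →
        c * |Real.log ‖χ.LFunction 1‖| ≤ Real.log x ^ (β / 2) →
          ∀ Q : ℝ, 1 ≤ Q → Q ≤ x ^ ((10 : ℝ) / 19 - ε) →
            ∀ a : ℕ → ℕ, (∀ q : ℕ, (a q).Coprime q) →
              ∑ q ∈ Finset.Icc ⌈Q⌉₊ ⌊2 * Q⌋₊,
                  |ParityWave0.chebyshevPsiMod q (a q : ZMod q) x -
                      Chebyshev.psi x / (q.totient : ℝ) *
                        (1 - (χ ((a q * (D / Nat.gcd q D) : ℕ) : ZMod D)).re)| ≤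
                K * (x * ‖χ.LFunction 1‖ * Real.log x ^ (9 - 8 * β) + Q ^ ((19 : ℝ) / 10 + ε))

/-- **Wright 2023 (preprint), Corollary 3.1 — CLAIM, as printed** (the Elliott–Halberstam-type
form without the twist term): "Let `χ`, `D`, `x`, and `β` be as above, and let `Q = x^θ` with
`θ < 10/19 − ε` for any `ε > 0`. Then
`∑_{q ∼ Q} max_{(a,q)=1} |ψ(x,q,a) − ψ(x)/φ(q)| ≪ x L(1,χ) log^{9−8β} x + Q^{19/10+ε}`." UNREFEREED;
not proved here. arXiv v1 display — SUPERSEDED by the author's v2 (`θ < 16/31 − ε`); see the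
module's VERSION CAVEAT. [claim: Wright2023PrimeDistributionSiegel, status: disputed] -/
def wright2023_primesAP_corollary31 : Prop :=
  ∀ β : ℝ, 0 < β → β < 1 → ∀ ε : ℝ, 0 < ε → ∃ c : ℝ, 0 < c ∧ ∃ K : ℝ, 0 < K ∧
    ∀ (D : ℕ) [NeZero D], 3 ≤ D → ∀ χ : DirichletCharacter ℂ D, χ.IsPrimitive → χ.IsQuadratic →
      ∀ x : ℝ, 2 ≤ x → Real.log D ≤ Real.log x ^ (1 - β) →
        c * |Real.log ‖χ.LFunction 1‖| ≤ Real.log x ^ (β / 2) →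
          ∀ Q : ℝ, 1 ≤ Q → Q ≤ x ^ ((10 : ℝ) / 19 - ε) →
            ∀ a : ℕ → ℕ, (∀ q : ℕ, (a q).Coprime q) →
              ∑ q ∈ Finset.Icc ⌈Q⌉₊ ⌊2 * Q⌋₊,
                  |ParityWave0.chebyshevPsiMod q (a q : ZMod q) x -
                      Chebyshev.psi x / (q.totient : ℝ)| ≤
                K * (x * ‖χ.LFunction 1‖ * Real.log x ^ (9 - 8 * β) + Q ^ ((19 : ℝ) / 10 + ε))

/-- **Wright 2023 (preprint), Corollary 5.2 "Brun–Titchmarsh with Siegel zeroes" — CLAIM, as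
printed.** "As before, let `x > q^{1+α}` for some `α > 0`. If `L(1,χ) < 1/log x` then
`∑_{p ≤ x; χ(p) = 1, p ≡ a (mod q)} 1 ≪ (x/q) L(1,χ)`." ("a sort of Brun–Titchmarsh theorem for the
primes where `χ(p) = 1` in the case where `χ` is an exceptional character … non-trivial when
`log x · L(1,χ) ≤ ε`.") "As before" carries the STANDING CONTEXT of §3 and of Lemma 5.1 ("For
some `α > 0`, let `x > q^{1+α}`, and assume that `L(1,χ) < 1/log x`. Let `β` be as in the Main
Theorems"): `0 < β < 1`, `(log x)^{1−β} ≥ log D`, `(log x)^{β/2} ≫ |log L(1,χ)|`, and `(a, q) = 1`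
(Shiu's theorem, on which the proof p. 9 runs, needs `(b, q) = 1`). Rendered WITH that standing
context (amended 2026-08-26 on the referee's V91 flag — the first rendering bound only `α`, which is
STRONGER than print, the unsafe direction for a claim): for every `0 < β < 1` and `α > 0` there are
`c, K > 0` such that for every `D ≥ 3`, primitive quadratic `χ` mod `D`, modulus `q ≥ 1`, residue
`a` coprime to `q`, and real `x > q^{1+α}` with `log D ≤ (log x)^{1−β}`,
`c |log ‖L(1,χ)‖| ≤ (log x)^{β/2}` and `‖L(1,χ)‖ < 1/log x`, the number of primes `p ≤ x` with
`χ(p) = 1` and `p ≡ a (mod q)` is at most `K x ‖L(1,χ)‖/q`. UNREFEREED; not proved here; to be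
re-checked against arXiv v2 when held (acq-11239).
[claim: Wright2023PrimeDistributionSiegel, status: under-review] -/
def wright2023_brunTitchmarsh_exceptional : Prop :=
  ∀ β : ℝ, 0 < β → β < 1 → ∀ α : ℝ, 0 < α → ∃ c : ℝ, 0 < c ∧ ∃ K : ℝ, 0 < K ∧
    ∀ (D : ℕ) [NeZero D], 3 ≤ D → ∀ χ : DirichletCharacter ℂ D, χ.IsPrimitive → χ.IsQuadratic →
      ∀ q : ℕ, 1 ≤ q → ∀ a : ℕ, a.Coprime q → ∀ x : ℝ, (q : ℝ) ^ (1 + α) < x →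
        Real.log D ≤ Real.log x ^ (1 - β) → c * |Real.log ‖χ.LFunction 1‖| ≤ Real.log x ^ (β / 2) →
        ‖χ.LFunction 1‖ < 1 / Real.log x →
          (((Finset.range (⌊x⌋₊ + 1)).filter fun p : ℕ =>
                p.Prime ∧ χ (p : ZMod D) = 1 ∧ p ≡ a [MOD q]).card : ℝ) ≤
            K * x * ‖χ.LFunction 1‖ / q

end Literature.NumberTheory.LFunctions

end
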